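import Summits.BirchSwinnertonDyer.Rank1Residual.X5.SelmerSolitairePivot
import HarnessLib

/-!
# O1 · the REBASING KIT of the Selmer solitaire, part 1: the explicit pivot position and the
# transport of `𝒳⁰` (cores, cube adjacency, connectivity) under re-basing

Cell `b2b-bsdres`, O1 (p = 2) PROVER ORDER v2.8 (ii′) (o1 PLAN §16; o1 lead R-G17.8: p4 = PivotRebase →
T4′), support for T4′ `Bad1ThreePrimeConnection` (lens-2 G5.9, whose proof moves the base).  Pure 𝔽₂
linear algebra; reach-neutral; nothing booked; no mark; O1 OPEN.  HONEST FRAMING (cell, verbatim):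
research route; the one plumbing definition below (`pivotPos`) is the object lens-2's proofs
manipulate ("re-base at a core vertex `X`"); nothing arithmetic is asserted.

* `pivotPos P X hX` — the position re-based at a core vertex `X`: adjacency matrix = the principal
  pivot transform of `Ŝ` at `X⁺` (`pivot`, `X5/SelmerSolitairePivotAux.lean`); `core_pivotPos_iff`:
  its cores are the translates `n ∆ X` (= `pivotRebase_holds`, with the witness named).
* `cubeAdj_pivotPos_iff`, `connected_pivotPos_iff` — `𝒳⁰` is transported by `n ↦ n ∆ X`: cube
  adjacency of `(n, m)` in the re-based position iff cube adjacency of `(n ∆ X, m ∆ X)`, and likewise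
  for connectivity (translation by `X` is an automorphism of the cube preserving Hamming distance 1).

Part 2 (one-vertex extensions vs. pivots: "pivot of an extension = extension of the pivot", with the
new row transformed by `ν ↦ (Ŝ[A]ν_A, ν_B + Ŝ[B,A]ν_A)`) follows in `X5/SelmerSolitaireRebaseExt.lean`,
on top of x11b3-p2 GEN 5's `extend` (T4 file).

References: lens-2 GEN 5, ROUTES-O1 §lens-2 G5.2 (T3 (ii)–(iii): moves and flips), G5.9 (T4′),
G5.10; A. Bouchet (1988) §3; M. J. Tsatsomeros, LAA 307 (2000). [cite: Tsatsomeros2000, Thm. 3.1]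
[cite: MazurRubin2004, §4.3]
-/

namespace Summit.BirchSwinnertonDyer.Rank1Residual.X5.SelmerSolitaire

open Finset Matrix

variable {s : ℕ}

/-! ## The explicit re-based position -/

/-- `det Ŝ[X⁺]` is a unit when `X` is core. [folklore] -/
theorem isUnit_det_of_core (P : Position s) (X : Finset (Fin s)) (hX : Core P X) :
    IsUnit (P.S.submatrix (Subtype.val : ↥(plus X) → V s) Subtype.val).det := by
  have h1 : (P.S.submatrix (Subtype.val : ↥(plus X) → V s) Subtype.val).det = 1 := hX
  rw [h1]; exact isUnit_one

/-- **The position re-based at a core vertex `X`**: its adjacency matrix is the principal pivot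
transform of `Ŝ` at `X⁺` (plumbing definition naming the witness of `PivotRebase`; lens-2 G5.2: "the
coordinate swap `u_ℓ ↔ t_ℓ` at `ℓ ∈ X`", T3 (iii) "FLIP = PIVOT"). [cite: Tsatsomeros2000, Thm. 3.1] -/
noncomputable def pivotPos (P : Position s) (X : Finset (Fin s)) (hX : Core P X) : Position s :=
  ⟨pivot P.S (plus X), pivot_isSymm P (plus X), pivot_apply_self P (plus X) (isUnit_det_of_core P X hX)⟩

/-- Unfolding lemma. [folklore] -/
theorem pivotPos_S (P : Position s) (X : Finset (Fin s)) (hX : Core P X) :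
    (pivotPos P X hX).S = pivot P.S (plus X) := rfl

/-- **Cores of the re-based position are the translates `n ∆ X`.** [cite: Tsatsomeros2000, Thm. 3.1] -/
theorem core_pivotPos_iff (P : Position s) (X : Finset (Fin s)) (hX : Core P X) (n : Finset (Fin s)) :
    Core (pivotPos P X hX) n ↔ Core P (symmDiff n X) := by
  show ((pivot P.S (plus X)).submatrix (Subtype.val : ↥(plus n) → V s) Subtype.val).det = 1 ↔
    (P.S.submatrix (fun x : ↥(plus (symmDiff n X)) => (x : V s))
      (fun x : ↥(plus (symmDiff n X)) => (x : V s))).det = 1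
  rw [det_submatrix_congr P.S (plus_symmDiff n X), Alt.eq_one_iff_ne_zero,
    Alt.eq_one_iff_ne_zero, Ne, det_submatrix_pivot_eq_zero_iff (isUnit_det_of_core P X hX) (plus n)]

/-- The base `∅` of the re-based position corresponds to `X`: `X` is core there iff `∅` was. [folklore] -/
theorem core_pivotPos_self (P : Position s) (X : Finset (Fin s)) (hX : Core P X) :
    Core (pivotPos P X hX) X ↔ Core P ∅ := by
  rw [core_pivotPos_iff, symmDiff_self]
  rfl

/-! ## Transport of the cube graph `𝒳⁰` under re-basing -/

/-- The cube adjacency "differ in exactly one element" in symmetric-difference form. [folklore] -/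
theorem subset_card_or_iff_card_symmDiff (n m : Finset (Fin s)) :
    ((n ⊆ m ∧ (m \ n).card = 1) ∨ (m ⊆ n ∧ (n \ m).card = 1)) ↔ (symmDiff n m).card = 1 := by
  have hdisj : Disjoint (n \ m) (m \ n) :=
    Finset.disjoint_left.2 fun x hx hx' => (Finset.mem_sdiff.1 hx').2 (Finset.mem_sdiff.1 hx).1
  have hcard : (symmDiff n m).card = (n \ m).card + (m \ n).card := by
    show ((n \ m) ∪ (m \ n)).card = _
    rw [Finset.card_union_of_disjoint hdisj]
  rw [hcard]
  constructor
  · rintro (⟨hsub, h1⟩ | ⟨hsub, h1⟩)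
    · rw [Finset.sdiff_eq_empty_iff_subset.mpr hsub, Finset.card_empty, zero_add, h1]
    · rw [Finset.sdiff_eq_empty_iff_subset.mpr hsub, Finset.card_empty, add_zero, h1]
  · intro h
    rcases Nat.eq_zero_or_pos (n \ m).card with h0 | hpos
    · left
      refine ⟨Finset.sdiff_eq_empty_iff_subset.mp (Finset.card_eq_zero.mp h0), by omega⟩
    · right
      have h0 : (m \ n).card = 0 := by omega
      exact ⟨Finset.sdiff_eq_empty_iff_subset.mp (Finset.card_eq_zero.mp h0), by omega⟩

/-- Translation by `X` preserves the symmetric difference: `(n ∆ X) ∆ (m ∆ X) = n ∆ m`. [folklore] -/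
theorem symmDiff_symmDiff_symmDiff_cancel (n m X : Finset (Fin s)) :
    symmDiff (symmDiff n X) (symmDiff m X) = symmDiff n m := by
  rw [symmDiff_symmDiff_symmDiff_comm, symmDiff_self, symmDiff_bot]

/-- **Cube adjacency is transported by re-basing**: `(n, m)` is an edge of `𝒳⁰` of the re-based position
iff `(n ∆ X, m ∆ X)` is an edge of `𝒳⁰(P)`. [cite: MazurRubin2004, §4.3] -/
theorem cubeAdj_pivotPos_iff (P : Position s) (X : Finset (Fin s)) (hX : Core P X) (n m : Finset (Fin s)) :
    CubeAdj (pivotPos P X hX) n m ↔ CubeAdj P (symmDiff n X) (symmDiff m X) := by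
  unfold CubeAdj
  rw [core_pivotPos_iff, core_pivotPos_iff, subset_card_or_iff_card_symmDiff,
    subset_card_or_iff_card_symmDiff, symmDiff_symmDiff_symmDiff_cancel]

/-- **Connectivity in `𝒳⁰` is transported by re-basing.** [cite: MazurRubin2004, §4.3] -/
theorem connected_pivotPos_iff (P : Position s) (X : Finset (Fin s)) (hX : Core P X) (n m : Finset (Fin s)) :
    Connected (pivotPos P X hX) n m ↔ Connected P (symmDiff n X) (symmDiff m X) := by
  unfold Connected
  constructor
  · intro h
    exact Relation.ReflTransGen.lift (r := CubeAdj (pivotPos P X hX)) (p := CubeAdj P)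
      (fun k => symmDiff k X) (fun a b hab => (cubeAdj_pivotPos_iff P X hX a b).mp hab) n m h
  · intro h
    have h' := Relation.ReflTransGen.lift (r := CubeAdj P) (p := CubeAdj (pivotPos P X hX))
      (fun k => symmDiff k X)
      (fun a b hab => by
        show CubeAdj (pivotPos P X hX) (symmDiff a X) (symmDiff b X)
        rw [cubeAdj_pivotPos_iff, symmDiff_symmDiff_cancel_right, symmDiff_symmDiff_cancel_right]
        exact hab) (symmDiff n X) (symmDiff m X) h
    have e1 : symmDiff (symmDiff n X) X = n := symmDiff_symmDiff_cancel_right _ _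
    have e2 : symmDiff (symmDiff m X) X = m := symmDiff_symmDiff_cancel_right _ _
    have h'' : Relation.ReflTransGen (CubeAdj (pivotPos P X hX)) (symmDiff (symmDiff n X) X)
        (symmDiff (symmDiff m X) X) := h'
    rwa [e1, e2] at h''

end Summit.BirchSwinnertonDyer.Rank1Residual.X5.SelmerSolitaire
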